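import Summits.BirchSwinnertonDyer.BirchSwinnertonDyer.Theorems.SignedLowerHalvesSprungLowerDivisibilityAtThreeCyclotomicLowerAtT
import Literature.NumberTheory.EllipticCurves.Sprung2012.SharpFlatColemanKatoZetaJoint
import HarnessLib

/-!
# Crux `SprungLowerDivisibilityAtThree` (item stmt-BirchSwinnertonDyer-19875), line `chromatic-common-zeros`:
# PER-PAIR census theorems — K1 for BOTH colours from a certificate on ONE colour
# (the "other colour" transfer through the shared zeta line)

Cell `bsd-ssimc` (host) / lead `cruxlead-stmt-BirchSwinnertonDyer-19875`; `--supports` 19875; theorems only; PER PAIR;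
closes no item; BSD / K1 / leaf X8 are NOT proved by anything here.

What is new. The tree's rank-one witnesses (`K1RankOne.sprungSharpFlatLowerDivisibility_of_lam_eq_one_of_analyticRank_eq_one_imageFree`,
p5xxxxx) prove the Eisenstein half `K1(E, •)` for the colour `•` that CARRIES the certificate `(μ, λ)(L^•) = (0, 1)`. The
line's lever (S1 `stub_squeezeToCommonZeros`, p606891) + the `(T)`-stub (S4a `stub_cyclotomicLowerAtT`, p608649) give it
for the OTHER colour as well, image-free: the common-zero locus of `(ϖL♯, ϖL♭)` is contained in the zero locus of the
certified colour — empty if that colour is a unit (R0), `{(T)}` if it is `T·(unit)` (R1) — and at `(T)` the colour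
transfer applies. So:
* (R0) `sprungSharpFlatLowerDivisibility_of_unitColour`: X8 pair, SOME colour `col₀` with `L^{col₀} ∈ Λˣ` (for the Sprung
  pair of every newform of `W`) ⟹ `K1(E, •)` for EVERY colour `•` (modulo `h714`, `h3`, the joint package `hJ`).
* (R1) `sprungSharpFlatLowerDivisibility_of_rankOne_certColour`: X8 pair with `r_an(E) = 1`, SOME colour `col₀` with
  `L^{col₀} ≠ 0`, `(μ, λ)(L^{col₀}) = (0, 1)` ⟹ `K1(E, •)` for EVERY colour (modulo `h714`, `h3`, `hGZK`, `hJ`).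
The joint package enters as the displayed NAMED FACT `hJ : Sprung2012.thm714seq_sharpFlatColemanKato_zetaJoint`
(W-β, p608011: Sprung 2012 Def. 7.12 / Thm. 7.14 (3) / Prop. 7.19 + Kato Thm. 12.6 on ONE `𝐇¹(T)`).
Census reading (card `Lines/chromatic-common-zeros.md`, "rank-1 cells close from one λ = 1 colour (37a1, 53a1
pattern)"): every X8 ∧ `r_an = 1` cell with ONE certified `(0, 1)` colour now has K1 in BOTH colours, image-free.

References: [Sprung2012] Thm. 7.14, Prop. 7.19, Main Conj. 7.21; [Sprung2017] Thm. 1.12, Cor. 4.11; [Sprung2024] §5.2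
Lemma 5.6; [GreenbergVatsal2000] Rem. 3.4; [Kato2004Asterisque] Thm. 12.5/12.6, §17.13; tree: `…SqueezeToCommonZeros`,
`…CyclotomicLowerAtT`, `Supersingular/SignedOrderOfVanishing` (`X8.chromaticL_eq_X_mul_unit_of_analyticRank_eq_one`).
-/

set_option linter.dupNamespace false
set_option autoImplicit false

noncomputable section

open scoped Classical NumberField MatrixGroups ModularForm

open NumberField IsDedekindDomain CongruenceSubgroup WeierstrassCurve Field
  Literature.NumberTheory.EllipticCurves Literature.NumberTheory.EllipticCurves.ModularForms
  Literature.NumberTheory.EllipticCurves.ZpExtension Literature.NumberTheory.EllipticCurves.Sprung2017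
  Literature.NumberTheory.EllipticCurves.Sprung2012 Literature.NumberTheory.EllipticCurves.Rank1Residual
  Literature.NumberTheory.EllipticCurves.IwasawaAlgebra
  Summit.BirchSwinnertonDyer.BirchSwinnertonDyer.Theorems
  Summit.BirchSwinnertonDyer.Rank1Residual.Supersingular
  Summit.BirchSwinnertonDyer.Rank1Residual.X1.MuLambda

namespace Summit.BirchSwinnertonDyer.BirchSwinnertonDyer.Theorems.ChromaticCommonZeros

variable (W : WeierstrassCurve ℚ) [W.IsElliptic] [W.IsGloballyMinimal] (p : ℕ) [Fact p.Prime]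

/-- **(R2) NO common zero ⟹ K1 for BOTH colours.** On an X8 pair, if for the Sprung pair of (every) newform `f` of
`W` and (every) period ratio `ϖ` EVERY height-one prime of `Λ` misses the Néron-normalised `L`-function of SOME colour
(the common-zero locus of `(ϖL♯, ϖL♭)` is EMPTY — per pair a finite 3-adic certificate: `gcd = 1`), then
`Theorems.SprungSharpFlatLowerDivisibility W p •` holds for EVERY colour `•` — the lever S1 with a vacuous hypothesis.
CONDITIONAL on the displayed `h714` (Sprung 2012 Thm. 7.14), `h3` (period unit at `3`) and the joint two-colour Coleman–Kato package `hJ`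
(`thm714seq_sharpFlatColemanKato_zetaJoint`, W-β). PER PAIR; image-free; rank-free.
[cite: Sprung2012, Thm. 7.14 (3) (p. 1504), Prop. 7.19 (p. 1505)] [cite: Kato2004Asterisque, Thm. 12.6 (p. 222)] -/
theorem sprungSharpFlatLowerDivisibility_of_noCommonZero (h714 : thm714_sharpFlatSelmerDual_finite_torsion)
    (h3 : realPeriodRat_eq_unit_mul_plusPeriod_three)
    (hJ : thm714seq_sharpFlatColemanKato_zetaJoint)
    (hX : ClassX8 W p)
    (hnc : ∀ {N : ℕ} [NeZero N] (f : CuspForm (Gamma0 N) 2) (ϖ : ℚ) (Lsharp Lflat : IwasawaAlgebra p),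
      IsNewformOf W f → (ϖ : ℝ) * W.realPeriodRat = plusPeriod f →
      IsSprungPair f p (W.frobeniusTrace p) Lsharp Lflat →
      ∀ 𝔭 : PrimeSpectrum (IwasawaAlgebra p), 𝔭.asIdeal.height = 1 →
        ∃ (col' : Chroma) (G' : IwasawaAlgebra p),
          iwasawaToPowerSeries p G' =
            PowerSeries.C (ϖ : ℚ_[p]) * iwasawaToPowerSeries p (chromaticL col' Lsharp Lflat) ∧
          G' ∉ 𝔭.asIdeal)
    (col : Chroma) : SprungSharpFlatLowerDivisibility W p col := by
  intro κ γ hκ hγ hcv v hv g hg cneg c hH N hN f ϖ Lsharp Lflat hf hϖ hSP hcol D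
  haveI : NeZero N := hN
  obtain ⟨hp3, ⟨hgood, hap⟩, -⟩ := id hX
  subst hp3
  haveI : ContinuousSMul ℤ_[3] (W.tateModule 3) := TateModule.continuousSMul_padicInt
  haveI : Module.Free ℤ_[3] (W.tateModule 3) := W.module_free_tateModule_holds 3
  haveI : Module.Finite ℤ_[3] (W.tateModule 3) := W.module_finite_tateModule_holds 3
  have hp2 : (3 : ℕ) ≠ 2 := by decide
  obtain ⟨hfinD, htorD⟩ :=
    h714 W 3 hp2 hgood hap f hf κ γ hκ hγ hcv v hv g hg cneg c hH col Lsharp Lflat hSP hcol D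
  haveI := hfinD
  obtain ⟨I⟩ := Kato2004.nonempty_iwasawaH1Data_holds W 3 κ γ hκ hγ
  obtain ⟨Cs, Cf, hZ⟩ := hJ W 3 f ϖ κ γ hp2 hgood hap hf hϖ hκ hγ hcv v hv g hg cneg c hH I
  have hϖ1 : ‖(ϖ : ℚ_[3])‖ = 1 := X8_norm_periodRatio_eq_one h3 W 3 hX hf hϖ
  have hG := (span_C_units_mul_eq (PadicInt.mkUnits hϖ1) (chromaticL col Lsharp Lflat)).2
  rw [PadicInt.mkUnits_eq] at hG
  refine stub_squeezeToCommonZeros W 3 hX col κ γ hκ hγ hcv v hv g hg cneg c hH N hN f ϖ Lsharp Lflat hf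
    hϖ hSP hcol D htorD _ hG I Cs Cf hZ ?_
  -- the common-zero locus is empty
  intro 𝔭 h𝔭 hcommon
  obtain ⟨col', G', hG', hG'𝔭⟩ := hnc f ϖ Lsharp Lflat hf hϖ hSP 𝔭 h𝔭
  exact absurd (hcommon col' G' hG') hG'𝔭

/-- **(R0) One UNIT colour ⟹ K1 for BOTH colours.** On an X8 pair, if for the Sprung pair of (every) newform of `W`
some colour `col₀` has `L^{col₀} ∈ Λˣ`, then the Eisenstein half `Theorems.SprungSharpFlatLowerDivisibility W p •`
holds for EVERY colour `•`: the common-zero locus of the two Néron-normalised functions is EMPTY (a unit lies in no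
prime), so the lever S1 applies with a vacuous hypothesis. CONDITIONAL on the displayed `h714` (Sprung 2012 Thm. 7.14),
`h3` (period unit at `3`) and the joint two-colour Coleman–Kato package `hJ` (`thm714seq_sharpFlatColemanKato_zetaJoint`). PER PAIR; image-free.
[cite: Sprung2012, Thm. 7.14 (3) (p. 1504), Prop. 7.19 (p. 1505)] [cite: Kato2004Asterisque, Thm. 12.6 (p. 222)]
[cite: GreenbergVatsal2000, §3 Remark 3.4] -/
theorem sprungSharpFlatLowerDivisibility_of_unitColour (h714 : thm714_sharpFlatSelmerDual_finite_torsion)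
    (h3 : realPeriodRat_eq_unit_mul_plusPeriod_three)
    (hJ : thm714seq_sharpFlatColemanKato_zetaJoint)
    (hX : ClassX8 W p) (col₀ : Chroma)
    (hunit : ∀ {N : ℕ} [NeZero N] (f : CuspForm (Gamma0 N) 2), IsNewformOf W f →
      ∀ Lsharp Lflat : IwasawaAlgebra p, IsSprungPair f p (W.frobeniusTrace p) Lsharp Lflat →
        IsUnit (chromaticL col₀ Lsharp Lflat))
    (col : Chroma) : SprungSharpFlatLowerDivisibility W p col := by
  refine sprungSharpFlatLowerDivisibility_of_noCommonZero W p h714 h3 hJ hX ?_ col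
  intro N _ f ϖ Lsharp Lflat hf hϖ hSP 𝔭 _h𝔭
  have hϖ1 : ‖(ϖ : ℚ_[p])‖ = 1 := X8_norm_periodRatio_eq_one h3 W p hX hf hϖ
  set u : ℤ_[p]ˣ := PadicInt.mkUnits hϖ1 with hu
  refine ⟨col₀, PowerSeries.C (u : ℤ_[p]) * chromaticL col₀ Lsharp Lflat, ?_, ?_⟩
  · rw [(span_C_units_mul_eq u (chromaticL col₀ Lsharp Lflat)).2, hu, PadicInt.mkUnits_eq]
  · exact fun hmem => 𝔭.isPrime.ne_top (Ideal.eq_top_of_isUnit_mem _ hmem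
      (((Units.isUnit u).map PowerSeries.C).mul (hunit f hf Lsharp Lflat hSP)))

/-- **(R1) Analytic rank one, ONE certified colour ⟹ K1 for BOTH colours.** On an X8 pair with `r_an(E) = 1`, if
for the Sprung pair of (every) newform of `W` some colour `col₀` has `L^{col₀} ≠ 0` and census certificate
`(μ, λ)(L^{col₀}) = (0, 1)` (so `L^{col₀} = T·u`, `u ∈ Λˣ`: `X8.chromaticL_eq_X_mul_unit_of_analyticRank_eq_one`),
then `Theorems.SprungSharpFlatLowerDivisibility W p •` holds for EVERY colour `•`: the common-zero locus is `⊆ {(T)}`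
and at `(T)` stub S4a (control + GZK for `col₀`, colour transfer to `•`) applies. CONDITIONAL on the displayed `h714`,
`h3`, `hGZK` (Gross–Zagier–Kolyvagin) and the joint package `hJ`. PER PAIR; image-free; the tree's
`K1RankOne.…_imageFree` gave only the certified colour.
[cite: Sprung2012, Thm. 7.14 (3) (p. 1504), Prop. 7.19 (p. 1505)] [cite: Sprung2017, Thm. 1.12 and Cor. 4.11]
[cite: Sprung2024, §5.2 Lemma 5.6 (p. 41)] [cite: GrossZagier1986, Thm. (7.3)] [cite: Kolyvagin1990, Thm. A] -/
theorem sprungSharpFlatLowerDivisibility_of_rankOne_certColour (h714 : thm714_sharpFlatSelmerDual_finite_torsion)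
    (h3 : realPeriodRat_eq_unit_mul_plusPeriod_three) (hGZK : rank_eq_analyticRank_of_analyticRank_le_one)
    (hJ : thm714seq_sharpFlatColemanKato_zetaJoint)
    (hX : ClassX8 W p) (h1 : W.analyticRank = 1) (col₀ : Chroma)
    (hcert : ∀ {N : ℕ} [NeZero N] (f : CuspForm (Gamma0 N) 2), IsNewformOf W f →
      ∀ Lsharp Lflat : IwasawaAlgebra p, IsSprungPair f p (W.frobeniusTrace p) Lsharp Lflat →
        chromaticL col₀ Lsharp Lflat ≠ 0 ∧ mu (chromaticL col₀ Lsharp Lflat) = 0 ∧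
          lam (chromaticL col₀ Lsharp Lflat) = 1)
    (col : Chroma) : SprungSharpFlatLowerDivisibility W p col := by
  intro κ γ hκ hγ hcv v hv g hg cneg c hH N hN f ϖ Lsharp Lflat hf hϖ hSP hcol D
  haveI : NeZero N := hN
  obtain ⟨hp3, ⟨hgood, hap⟩, -⟩ := id hX
  subst hp3
  haveI : ContinuousSMul ℤ_[3] (W.tateModule 3) := TateModule.continuousSMul_padicInt
  haveI : Module.Free ℤ_[3] (W.tateModule 3) := W.module_free_tateModule_holds 3
  haveI : Module.Finite ℤ_[3] (W.tateModule 3) := W.module_finite_tateModule_holds 3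
  have hp2 : (3 : ℕ) ≠ 2 := by decide
  obtain ⟨hfinD, htorD⟩ :=
    h714 W 3 hp2 hgood hap f hf κ γ hκ hγ hcv v hv g hg cneg c hH col Lsharp Lflat hSP hcol D
  haveI := hfinD
  obtain ⟨I⟩ := Kato2004.nonempty_iwasawaH1Data_holds W 3 κ γ hκ hγ
  obtain ⟨Cs, Cf, hZ⟩ := hJ W 3 f ϖ κ γ hp2 hgood hap hf hϖ hκ hγ hcv v hv g hg cneg c hH I
  have hϖ1 : ‖(ϖ : ℚ_[3])‖ = 1 := X8_norm_periodRatio_eq_one h3 W 3 hX hf hϖ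
  set u : ℤ_[3]ˣ := PadicInt.mkUnits hϖ1 with hu
  have hnorm : ∀ c' : Chroma,
      iwasawaToPowerSeries 3 (PowerSeries.C (u : ℤ_[3]) * chromaticL c' Lsharp Lflat) =
        PowerSeries.C (ϖ : ℚ_[3]) * iwasawaToPowerSeries 3 (chromaticL c' Lsharp Lflat) := by
    intro c'
    rw [(span_C_units_mul_eq u (chromaticL c' Lsharp Lflat)).2, hu, PadicInt.mkUnits_eq]
  -- the certified colour: `L^{col₀} = T · w`, `w ∈ Λˣ`, `ord_T L^{col₀} = 1`
  obtain ⟨hL₀, hμ, hlam⟩ := hcert f hf Lsharp Lflat hSP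
  obtain ⟨⟨w, hw⟩, hord, -⟩ := X8.chromaticL_eq_X_mul_unit_of_analyticRank_eq_one hX h1 hf hSP col₀ hL₀ hμ hlam
  refine stub_squeezeToCommonZeros W 3 hX col κ γ hκ hγ hcv v hv g hg cneg c hH N hN f ϖ Lsharp Lflat hf
    hϖ hSP hcol D htorD _ (hnorm col) I Cs Cf hZ ?_
  intro 𝔭 h𝔭 hcommon
  -- a common zero contains `G^{col₀} = T · (unit)`, hence `T`
  have hmem := hcommon col₀ _ (hnorm col₀)
  have hT : (PowerSeries.X : IwasawaAlgebra 3) ∈ 𝔭.asIdeal := by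
    rw [hw, ← mul_assoc, mul_comm (PowerSeries.C (u : ℤ_[3])) PowerSeries.X, mul_assoc] at hmem
    rcases 𝔭.isPrime.mem_or_mem hmem with hx | hrest
    · exact hx
    · exact absurd (Ideal.eq_top_of_isUnit_mem _ hrest
        (((Units.isUnit u).map PowerSeries.C).mul (Units.isUnit w))) 𝔭.isPrime.ne_top
  exact stub_cyclotomicLowerAtT h714 h3 hGZK W 3 hX col κ γ hκ hγ hcv v hv g hg cneg c hH N hN f ϖ Lsharp
    Lflat hf hϖ hSP hcol D htorD _ (hnorm col) I Cs Cf hZ 𝔭 h𝔭 hT h1.le (fun _ => ⟨col₀, hord⟩) hcommon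

end Summit.BirchSwinnertonDyer.BirchSwinnertonDyer.Theorems.ChromaticCommonZeros

end
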